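import Summits.ResolutionOfSingularities.ResolutionOfSingularities.Theorems.FrobeniusLadderFInjectiveMacaulayficationDiagonalPairTruncations
import HarnessLib

/-!
# (U-T) THE TWO-RATIO DIAGONAL PAIRS `(Σ cᵢxᵢ^{aᵢ}, Σ_P dᵢxᵢ^{aᵢ} + Σ_{∁P} dᵢxᵢ^{2aᵢ})`: the torus-minor condition, hence Khovanskii non-degeneracy and regularity off the vertex
# (crux `FInjectiveMacaulayfication` stmt-ResolutionOfSingularities-15315, chain w45a; res-L1-w45a-plan-1 RULINGs R23.25 (β) / R23.29 «(T) TwoRatioDiagonalPair» — the UNEQUAL-SUPPORT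
# (non-homothetic) family containing BED CI-3 `(x₀²+x₁³+x₂⁵+x₃⁵+x₄⁷+x₅⁷, x₀²+2x₁³+x₂¹⁰+x₃¹⁰+x₄¹⁴+x₅¹⁴)`; seat res-L1-w45a-stub-2 g13)

[OURS · L1 W4.5a] Support file (`--supports stmt-ResolutionOfSingularities-15315 --as helper`); def-free; UNCONDITIONAL; no named fact, no sorry; NOT a statement of any manuscript;
replaces the role of NO printed item. Nothing of the crux is proved. AI-written (AI review weaker than expert review).

THE FAMILY. Index set `{0..n−1} = P ⊔ ∁P`; `F₀ = Σᵢ cᵢxᵢ^{aᵢ}`, `F₁ = Σᵢ dᵢxᵢ^{bᵢ}` with `bᵢ = aᵢ` on `P` and `bᵢ = 2aᵢ` off `P` (exponent RATIO `bᵢ/aᵢ ∈ {1, 2}` — two values,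
so the Newton simplices are NOT homothetic as soon as `P ≠ ∅ ≠ ∁P`); all `cᵢ, dᵢ ≠ 0`, `aᵢ ≥ 1` with `aᵢ ≠ 0 ≠ 2` in the field; NUMERICAL CONDITIONS: the `2 × 2` minors
`cᵢdⱼ − cⱼdᵢ ≠ 0` for `i ≠ j` in `P`, and the SUBSET SUMS `Σ_{i ∈ S} cᵢ²/dᵢ ≠ 0` for every non-empty `S ⊆ ∁P`.
* §1 ★ `minor_ne_zero_of_truncation` — THE CORE COMPUTATION (any field `L`): if `ξᵢ ≠ 0` on a non-empty `S` and `Σ_S cᵢξᵢ^{aᵢ} = 0 = Σ_S dᵢξᵢ^{bᵢ}`, some Jacobian minor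
  `aᵢcᵢξᵢ^{aᵢ−1}·bⱼdⱼξⱼ^{bⱼ−1} − (i ↔ j)` is non-zero (`i, j ∈ S`). PROOF (the `λ`-bookkeeping made explicit, desk R23.29): were all minors zero, the two gradient rows
  `αᵢ = aᵢcᵢξᵢ^{aᵢ−1}`, `βᵢ = bᵢdᵢξᵢ^{bᵢ−1}` (BOTH non-zero at every `i ∈ S`, as `aᵢ, bᵢ, cᵢ, dᵢ, ξᵢ ≠ 0`) would be proportional, `αᵢ = λβᵢ` with `λ = α_{i₀}/β_{i₀} ≠ 0`;
  multiplying by `ξᵢ`: `cᵢ = λdᵢ` on `S ∩ P` and `cᵢ = 2λdᵢξᵢ^{aᵢ}` on `S ∖ P`; with `uᵢ = dᵢξᵢ^{bᵢ}` the two vanishing sums read `U_P + U_{∁P} = 0` and `λU_P + 2λU_{∁P} = 0`,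
  so `U_{∁P} = 0`; if `S ∖ P ≠ ∅` then `U_{∁P} = Σ_{S∖P} cᵢ²/(4λ²dᵢ) ≠ 0` — contradiction; otherwise `S ⊆ P`, and either two indices contradict a minor (`cᵢdⱼ = λdᵢdⱼ = cⱼdᵢ`) or
  `S = {i}` contradicts `dᵢξᵢ^{bᵢ} = 0`.
* §2 ★ `ciNondegenerate_twoRatio` — Khovanskii non-degeneracy along every positive weight (✓`DiagonalPairTruncations.ciNondegenerate_of_faces` + §1).
* §3 ★ `isRegularLocalRing_off_vertex_twoRatio` — `(k[x]/(F₀,F₁))_Q` regular at every prime `Q ⊉ (x̄)` (✓`DiagonalPairTruncations.isRegularLocalRing_off_vertex_of_points` + §1 over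
  every field `L ⊇ k`, the numerical conditions transported along `k → L`).
[cite: CuetoPopescupampuStepanov2023, Def. 4.2 (p. 12)] [cite: Matsumura1987, Thm. 30.4 (ii)]
-/

-- single-problem summit: the doubled namespace component is forced
set_option linter.dupNamespace false

noncomputable section

open MvPolynomial

namespace Summit.ResolutionOfSingularities.ResolutionOfSingularities.Theorems.FInjectiveMacaulayfication.TwoRatioDiagonalPair

open Summit.ResolutionOfSingularities.ResolutionOfSingularities.Theorems.FInjectiveMacaulayfication
open Literature.AlgebraicGeometry.Resolution Literature.AlgebraicGeometry.Resolution.BoubakriGreuelMarkwig CINondegenerate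

variable {L : Type} [Field L] {n : ℕ}

/-! ## §1 ★ The core computation -/

/-- `bᵢ ≠ 0` in the field for the two-ratio exponents. [plumbing] -/
theorem cast_b_ne_zero (P : Finset (Fin n)) (a b : Fin n → ℕ) (hbP : ∀ i ∈ P, b i = a i) (hbQ : ∀ i, i ∉ P → b i = 2 * a i)
    (haL : ∀ i, ((a i : ℕ) : L) ≠ 0) (h2 : (2 : L) ≠ 0) (i : Fin n) : ((b i : ℕ) : L) ≠ 0 := by
  by_cases hi : i ∈ P
  · rw [hbP i hi]; exact haL i
  · rw [hbQ i hi, Nat.cast_mul, Nat.cast_two]; exact mul_ne_zero h2 (haL i)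

/-- `bᵢ ≥ aᵢ` (so `bᵢ ≥ 1`, resp. `≥ 2`, when `aᵢ` is). [plumbing] -/
theorem le_b (P : Finset (Fin n)) (a b : Fin n → ℕ) (hbP : ∀ i ∈ P, b i = a i) (hbQ : ∀ i, i ∉ P → b i = 2 * a i) (i : Fin n) : a i ≤ b i := by
  by_cases hi : i ∈ P
  · rw [hbP i hi]
  · rw [hbQ i hi]; omega

set_option maxHeartbeats 800000 in
-- elementary but long
/-- ★ **THE CORE COMPUTATION** for the two-ratio family (module docstring §1): on a non-empty index set `S` carrying a torus point `ξ` with `Σ_S cᵢξᵢ^{aᵢ} = 0 = Σ_S dᵢξᵢ^{bᵢ}`,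
some Jacobian minor `aᵢcᵢξᵢ^{aᵢ−1}·bⱼdⱼξⱼ^{bⱼ−1} ≠ aⱼcⱼξⱼ^{aⱼ−1}·bᵢdᵢξᵢ^{bᵢ−1}` (`i, j ∈ S`). [OURS · elementary certificate] -/
theorem minor_ne_zero_of_truncation (P : Finset (Fin n)) (a b : Fin n → ℕ) (hbP : ∀ i ∈ P, b i = a i) (hbQ : ∀ i, i ∉ P → b i = 2 * a i)
    (ha : ∀ i, a i ≠ 0) (haL : ∀ i, ((a i : ℕ) : L) ≠ 0) (h2 : (2 : L) ≠ 0) (c d : Fin n → L) (hc : ∀ i, c i ≠ 0) (hd : ∀ i, d i ≠ 0)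
    (hminor : ∀ i ∈ P, ∀ j ∈ P, i ≠ j → c i * d j ≠ c j * d i)
    (hsum : ∀ S : Finset (Fin n), S.Nonempty → (∀ i ∈ S, i ∉ P) → ∑ i ∈ S, c i ^ 2 / d i ≠ 0)
    (S : Finset (Fin n)) (hS : S.Nonempty) (ξ : Fin n → L) (hξ : ∀ i ∈ S, ξ i ≠ 0)
    (hz₀ : ∑ i ∈ S, c i * ξ i ^ a i = 0) (hz₁ : ∑ i ∈ S, d i * ξ i ^ b i = 0) :
    ∃ i ∈ S, ∃ j ∈ S, c i * (((a i : ℕ) : L) * ξ i ^ (a i - 1)) * (d j * (((b j : ℕ) : L) * ξ j ^ (b j - 1))) ≠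
      c j * (((a j : ℕ) : L) * ξ j ^ (a j - 1)) * (d i * (((b i : ℕ) : L) * ξ i ^ (b i - 1))) := by
  classical
  have hbL := cast_b_ne_zero P a b hbP hbQ haL h2
  by_contra hall
  push Not at hall
  obtain ⟨i₀, hi₀⟩ := hS
  -- the two gradient rows, both non-zero on `S`
  have hαne : ∀ i ∈ S, c i * (((a i : ℕ) : L) * ξ i ^ (a i - 1)) ≠ 0 := fun i hi =>
    mul_ne_zero (hc i) (mul_ne_zero (haL i) (pow_ne_zero _ (hξ i hi)))
  have hβne : ∀ i ∈ S, d i * (((b i : ℕ) : L) * ξ i ^ (b i - 1)) ≠ 0 := fun i hi =>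
    mul_ne_zero (hd i) (mul_ne_zero (hbL i) (pow_ne_zero _ (hξ i hi)))
  -- the (degenerate-branch-free) proportionality constant `λ = α_{i₀}/β_{i₀} ≠ 0`
  set lam : L := c i₀ * (((a i₀ : ℕ) : L) * ξ i₀ ^ (a i₀ - 1)) / (d i₀ * (((b i₀ : ℕ) : L) * ξ i₀ ^ (b i₀ - 1))) with hlam
  have hlamne : lam ≠ 0 := div_ne_zero (hαne i₀ hi₀) (hβne i₀ hi₀)
  have hprop : ∀ i ∈ S, c i * (((a i : ℕ) : L) * ξ i ^ (a i - 1)) = lam * (d i * (((b i : ℕ) : L) * ξ i ^ (b i - 1))) := by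
    intro i hi
    have h := hall i hi i₀ hi₀
    rw [hlam, div_mul_eq_mul_div, eq_div_iff (hβne i₀ hi₀)]
    linear_combination h
  have hpowa : ∀ i, ξ i * ξ i ^ (a i - 1) = ξ i ^ a i := fun i => by
    rw [← pow_succ', Nat.sub_add_cancel (Nat.one_le_iff_ne_zero.mpr (ha i))]
  -- on `S ∩ P`: `cᵢ = λ dᵢ`
  have hP : ∀ i ∈ S, i ∈ P → c i = lam * d i := by
    intro i hi hiP
    have h := hprop i hi
    rw [hbP i hiP] at h
    have hne : ((a i : ℕ) : L) * ξ i ^ (a i - 1) ≠ 0 := mul_ne_zero (haL i) (pow_ne_zero _ (hξ i hi))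
    have h' : (c i - lam * d i) * (((a i : ℕ) : L) * ξ i ^ (a i - 1)) = 0 := by linear_combination h
    exact sub_eq_zero.mp ((mul_eq_zero.mp h').resolve_right hne)
  -- on `S ∖ P`: `cᵢ = 2λ dᵢ ξᵢ^{aᵢ}`
  have hQ : ∀ i ∈ S, i ∉ P → 2 * lam * d i * ξ i ^ a i = c i := by
    intro i hi hiP
    have h := hprop i hi
    rw [hbQ i hiP] at h
    push_cast at h
    have e_a := hpowa i
    have e_b : ξ i * ξ i ^ (2 * a i - 1) = ξ i ^ a i * ξ i ^ a i := by
      rw [← pow_succ', Nat.sub_add_cancel (by have := ha i; omega : 1 ≤ 2 * a i), two_mul, pow_add]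
    have hne : ((a i : ℕ) : L) * ξ i ^ a i ≠ 0 := mul_ne_zero (haL i) (pow_ne_zero _ (hξ i hi))
    have h' : (c i - 2 * lam * d i * ξ i ^ a i) * (((a i : ℕ) : L) * ξ i ^ a i) = 0 := by
      linear_combination ξ i * h - c i * ((a i : ℕ) : L) * e_a + 2 * lam * d i * ((a i : ℕ) : L) * e_b
    exact (sub_eq_zero.mp ((mul_eq_zero.mp h').resolve_right hne)).symm
  -- the two vanishing sums split along `P`
  have hsplit₁ : ∑ i ∈ S.filter (fun i => i ∈ P), d i * ξ i ^ b i + ∑ i ∈ S.filter (fun i => i ∉ P), d i * ξ i ^ b i = 0 := by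
    rw [Finset.sum_filter_add_sum_filter_not]; exact hz₁
  have hrewrite : ∑ i ∈ S, c i * ξ i ^ a i =
      lam * ∑ i ∈ S.filter (fun i => i ∈ P), d i * ξ i ^ b i + 2 * lam * ∑ i ∈ S.filter (fun i => i ∉ P), d i * ξ i ^ b i := by
    rw [← Finset.sum_filter_add_sum_filter_not S (fun i => i ∈ P), Finset.mul_sum, Finset.mul_sum]
    congr 1
    · refine Finset.sum_congr rfl fun i hi => ?_
      obtain ⟨hiS, hiP⟩ := Finset.mem_filter.mp hi
      rw [hbP i hiP, hP i hiS hiP]; ring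
    · refine Finset.sum_congr rfl fun i hi => ?_
      obtain ⟨hiS, hiP⟩ := Finset.mem_filter.mp hi
      rw [hbQ i hiP, pow_mul', ← hQ i hiS hiP]; ring
  have hsplit₀ : lam * ∑ i ∈ S.filter (fun i => i ∈ P), d i * ξ i ^ b i + 2 * lam * ∑ i ∈ S.filter (fun i => i ∉ P), d i * ξ i ^ b i = 0 := by
    rw [← hrewrite]; exact hz₀
  have hUQ : ∑ i ∈ S.filter (fun i => i ∉ P), d i * ξ i ^ b i = 0 := by
    have h : lam * ∑ i ∈ S.filter (fun i => i ∉ P), d i * ξ i ^ b i = 0 := by linear_combination hsplit₀ - lam * hsplit₁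
    exact (mul_eq_zero.mp h).resolve_left hlamne
  by_cases hSQ : (S.filter (fun i => i ∉ P)).Nonempty
  · -- `S ∖ P ≠ ∅`: the subset sum `Σ cᵢ²/dᵢ` over it would vanish
    apply hsum (S.filter (fun i => i ∉ P)) hSQ (fun i hi => (Finset.mem_filter.mp hi).2)
    have h : ∑ i ∈ S.filter (fun i => i ∉ P), c i ^ 2 / d i = 4 * lam ^ 2 * ∑ i ∈ S.filter (fun i => i ∉ P), d i * ξ i ^ b i := by
      rw [Finset.mul_sum]
      refine Finset.sum_congr rfl fun i hi => ?_
      obtain ⟨hiS, hiP⟩ := Finset.mem_filter.mp hi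
      rw [hbQ i hiP, pow_mul', ← hQ i hiS hiP]
      field_simp [hd i]
      ring
    rw [h, hUQ, mul_zero]
  · -- `S ⊆ P`
    have hSP : ∀ i ∈ S, i ∈ P := fun i hi => by
      by_contra hiP
      exact hSQ ⟨i, Finset.mem_filter.mpr ⟨hi, hiP⟩⟩
    by_cases htwo : ∃ j ∈ S, j ≠ i₀
    · obtain ⟨j, hj, hji⟩ := htwo
      apply hminor i₀ (hSP i₀ hi₀) j (hSP j hj) (Ne.symm hji)
      rw [hP i₀ hi₀ (hSP i₀ hi₀), hP j hj (hSP j hj)]; ring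
    · push Not at htwo
      have hSeq : S = {i₀} := Finset.eq_singleton_iff_unique_mem.mpr ⟨hi₀, htwo⟩
      rw [hSeq, Finset.sum_singleton] at hz₁
      exact mul_ne_zero (hd i₀) (pow_ne_zero _ (hξ i₀ hi₀)) hz₁

/-! ## §2 ★ Khovanskii non-degeneracy -/

/-- ★ **A TWO-RATIO DIAGONAL PAIR IS KHOVANSKII NON-DEGENERATE ALONG EVERY POSITIVE WEIGHT** under the numerical conditions (module docstring). [OURS · elementary certificate; cite:
CuetoPopescupampuStepanov2023, Def. 4.2 (p. 12)] -/
theorem ciNondegenerate_twoRatio (hn : 0 < n) (P : Finset (Fin n)) (a b : Fin n → ℕ) (hbP : ∀ i ∈ P, b i = a i) (hbQ : ∀ i, i ∉ P → b i = 2 * a i)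
    (ha : ∀ i, a i ≠ 0) (haL : ∀ i, ((a i : ℕ) : L) ≠ 0) (h2 : (2 : L) ≠ 0) (c d : Fin n → L) (hc : ∀ i, c i ≠ 0) (hd : ∀ i, d i ≠ 0)
    (hminor : ∀ i ∈ P, ∀ j ∈ P, i ≠ j → c i * d j ≠ c j * d i)
    (hsum : ∀ S : Finset (Fin n), S.Nonempty → (∀ i ∈ S, i ∉ P) → ∑ i ∈ S, c i ^ 2 / d i ≠ 0)
    (F : Fin 2 → MvPolynomial (Fin n) L) (hF0 : F 0 = ∑ i : Fin n, monomial (Finsupp.single i (a i)) (c i))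
    (hF1 : F 1 = ∑ i : Fin n, monomial (Finsupp.single i (b i)) (d i)) :
    ∀ w : Fin n → ℝ, (∀ i, 0 < w i) → IsCINondegenerateAlong w (fun l => (F l : MvPowerSeries (Fin n) L)) :=
  DiagonalPairTruncations.ciNondegenerate_of_faces hn a b ha (fun i => by have := le_b P a b hbP hbQ i; have := ha i; omega) haL
    (cast_b_ne_zero P a b hbP hbQ haL h2) c d hc hd
    (fun S hS _ q hq hz₀ hz₁ => minor_ne_zero_of_truncation P a b hbP hbQ ha haL h2 c d hc hd hminor hsum S (Finset.card_pos.mp (by omega)) q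
      (fun i _ => hq i) hz₀ hz₁) F hF0 hF1

/-! ## §3 ★ Regularity off the vertex -/

/-- ★ **`(k[x]/(F₀, F₁))_Q` IS REGULAR AT EVERY PRIME `Q ⊉ (x̄)`** for a two-ratio diagonal pair with `aᵢ ≥ 2` under the numerical conditions (module docstring): §1 over every field
`L ⊇ k` feeds ✓`DiagonalPairTruncations.isRegularLocalRing_off_vertex_of_points`. [OURS · elementary certificate; cite: Matsumura1987, Thm. 30.4 (ii)] -/
theorem isRegularLocalRing_off_vertex_twoRatio (p : ℕ) [Fact p.Prime] {k : Type} [Field k] [CharP k p] (P : Finset (Fin n)) (a b : Fin n → ℕ)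
    (hbP : ∀ i ∈ P, b i = a i) (hbQ : ∀ i, i ∉ P → b i = 2 * a i) (ha2 : ∀ i, 2 ≤ a i) (hak : ∀ i, ((a i : ℕ) : k) ≠ 0) (h2 : (2 : k) ≠ 0)
    (c d : Fin n → k) (hc : ∀ i, c i ≠ 0) (hd : ∀ i, d i ≠ 0) (hminor : ∀ i ∈ P, ∀ j ∈ P, i ≠ j → c i * d j ≠ c j * d i)
    (hsum : ∀ S : Finset (Fin n), S.Nonempty → (∀ i ∈ S, i ∉ P) → ∑ i ∈ S, c i ^ 2 / d i ≠ 0)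
    (F : Fin 2 → MvPolynomial (Fin n) k) (hF0 : F 0 = ∑ i : Fin n, monomial (Finsupp.single i (a i)) (c i))
    (hF1 : F 1 = ∑ i : Fin n, monomial (Finsupp.single i (b i)) (d i))
    (Q : Ideal (MvPolynomial (Fin n) k ⧸ Ideal.span (Set.range F))) [Q.IsPrime]
    (hQ : ¬ Ideal.span (Set.range fun j : Fin n => Ideal.Quotient.mk (Ideal.span (Set.range F)) (X j)) ≤ Q) :
    IsRegularLocalRing (Localization.AtPrime Q) := by
  refine DiagonalPairTruncations.isRegularLocalRing_off_vertex_of_points p a b ha2 (fun i => le_trans (ha2 i) (le_b P a b hbP hbQ i)) c d F hF0 hF1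
    (fun L _ φ S hS ξ hξ _ hz₀ hz₁ => ?_) Q hQ
  have hinj := φ.injective
  have haL : ∀ i, ((a i : ℕ) : L) ≠ 0 := fun i => by rw [← map_natCast φ]; exact (map_ne_zero_iff φ hinj).mpr (hak i)
  have h2L : (2 : L) ≠ 0 := by rw [← map_ofNat φ 2]; exact (map_ne_zero_iff φ hinj).mpr h2
  have hsumL : ∀ S : Finset (Fin n), S.Nonempty → (∀ i ∈ S, i ∉ P) → ∑ i ∈ S, φ (c i) ^ 2 / φ (d i) ≠ 0 := by
    intro S hS hSP
    have h : ∑ i ∈ S, φ (c i) ^ 2 / φ (d i) = φ (∑ i ∈ S, c i ^ 2 / d i) := by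
      rw [map_sum]
      exact Finset.sum_congr rfl fun i _ => by rw [map_div₀, map_pow]
    rw [h]
    exact (map_ne_zero_iff φ hinj).mpr (hsum S hS hSP)
  exact minor_ne_zero_of_truncation P a b hbP hbQ (fun i => by have := ha2 i; omega) haL h2L (fun i => φ (c i)) (fun i => φ (d i))
    (fun i => (map_ne_zero_iff φ hinj).mpr (hc i)) (fun i => (map_ne_zero_iff φ hinj).mpr (hd i))
    (fun i hi j hj hij => by rw [← map_mul, ← map_mul]; exact fun h => hminor i hi j hj hij (hinj h)) hsumL S hS ξ hξ hz₀ hz₁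

end Summit.ResolutionOfSingularities.ResolutionOfSingularities.Theorems.FInjectiveMacaulayfication.TwoRatioDiagonalPair

end
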